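import Literature.AlgebraicGeometry.Hironaka2017.Lib.FrobeniusPBasis
import Literature.AlgebraicGeometry.Resolution.RegularSystemOfParameters
import Literature.AlgebraicGeometry.Resolution.RegularLocalRingsProofs
import Mathlib.Algebra.CharP.Lemmas
import Mathlib.Algebra.CharP.Reduced
import Mathlib.Algebra.CharP.Subring
import HarnessLib

/-!
# Crux `Steer` (stmt-ResolutionOfSingularities-16345), chain W4.1 — §σ2.20 NORMALISED START, piece **(N5)**
# `exists_global_of_local_frobenius_congruence`: a LOCAL Frobenius congruence along a prime divisor is GLOBAL

OURS (campaign `res-hironaka`, rung L, slot W4.1, chain W4.1; replaces the role of no printed item; NOT a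
statement of the manuscript under review [claim: Hironaka2017, status: under-review]; AI review is weaker
than expert review).  Theses-free, definition-free helper for the σ-residual of the line of record
`Cruxes/Steer/Lines/switching_dichotomy.lean` (holder res-L0-w41-lead-1, r24), res-L0-w41-plan-1 RULING 7 (g8)
«§σ2.20 NORMALISED START», piece (N5) «LOCAL–GLOBAL CARRIER» (the one new algebra input of the propagation
(N4) `noSingularCarrier_along_run`, consumer res-type-082, by name):

> **(N5).** Let `R` be a regular local ring of characteristic `p`, F-finite, with PERFECT residue field, `π ∈ R`
> a prime element and `f ∈ R`.  If `f ≡ θ ^ p (mod π ^ p R_{(π)})` for some `θ ∈ R_{(π)}`, then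
> `f ≡ g ^ p (mod π ^ p R)` for some `g ∈ R`.

Denominators cleared, the hypothesis reads `π ^ p ∣ s ^ p · f − a ^ p` with `π ∤ s` (`θ = a / s`); this is the
core statement `exists_global_of_local_frobenius_congruence`.  The subring form
`exists_global_of_local_frobenius_congruence_subring` (members of a run are subrings of the function field `K`,
`θ, ρ ∈ K` fractions with denominators prime to `π`, `f − θ ^ p = π ^ p · ρ`) is the shape the propagation
consumes.

## Proof (namespace `…Theorems.SwitchingDichotomy.FrobeniusCongruence`)

KUNZ: `R` is FREE over `R^p = ρ(R)` on the monomials `x^α` (`α ∈ [0, p)^d`) of a regular system of parameters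
`x` (lane library `S02Preliminaries.exists_basis_frobeniusPower_monomials`, res-D-lib-2).  Write
`f = Σ_α c_α x^α`, `c_α = γ_α ^ p`.  Since `s ^ p`, `a ^ p = a ^ p · x^0` and `π ^ p` are COEFFICIENTS, comparing
the `x^α`-coordinates (`α ≠ 0`) of `s ^ p · f − a ^ p = π ^ p · r` gives `s ^ p γ_α ^ p = π ^ p r_α`, `r_α = ϱ_α ^ p`,
so `s γ_α = π ϱ_α` (Frobenius is injective on the domain `R`), whence `π ∣ γ_α` (`π` prime, `π ∤ s`) and
`π ^ p ∣ c_α x^α` for every `α ≠ 0`; thus `π ^ p ∣ f − c_0 = f − γ_0 ^ p`.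

Elementary over the lane library; no named facts, no definitions, no `sorry`. [cite: Kunz1969, Thm. 2.1]
[cite: Matsumura1987, §30 Lemma 1 (context: p-bases of regular local rings)] [folklore]
-/

noncomputable section

-- `Summit.<S>.<S>.…` duplicates the summit name by design (single-problem summit).
set_option linter.dupNamespace false
set_option autoImplicit false

namespace Summit.ResolutionOfSingularities.ResolutionOfSingularities.Theorems.SwitchingDichotomy.FrobeniusCongruence

open IsLocalRing
open Literature.AlgebraicGeometry.Resolution (IsFFinite exists_regularSystemOfParameters
  isDomain_of_isRegularLocalRing)
open Literature.AlgebraicGeometry.Hironaka2017.S02Preliminaries (frobeniusPowerSubring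
  mem_frobeniusPowerSubring_iff exists_basis_frobeniusPower_monomials)

universe u

/-! ### The core: divisibility form -/

section Core

variable {R : Type u} [CommRing R] {p : ℕ} [Fact p.Prime] [CharP R p]

/-- Elements of `ρ(R) = R^p` are `p`-th powers. [folklore] -/
theorem exists_pow_eq_of_mem {c : R} (hc : c ∈ frobeniusPowerSubring R p 1) : ∃ γ : R, γ ^ p = c := by
  obtain ⟨γ, hγ⟩ := mem_frobeniusPowerSubring_iff.mp hc
  exact ⟨γ, by rwa [pow_one] at hγ⟩

/-- `p`-th powers lie in `ρ(R) = R^p`. [folklore] -/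
theorem pow_mem_frobeniusPowerSubring_one (γ : R) : γ ^ p ∈ frobeniusPowerSubring R p 1 :=
  mem_frobeniusPowerSubring_iff.mpr ⟨γ, by rw [pow_one]⟩

/-- **(N5) · LOCAL–GLOBAL FROBENIUS CONGRUENCE, core (divisibility form).** `R` regular local of
characteristic `p`, F-finite, residue field perfect; `π ∈ R` prime; `f, a, s ∈ R` with `π ∤ s` and
`π ^ p ∣ s ^ p · f − a ^ p` (i.e. `f ≡ (a/s) ^ p` modulo `π ^ p` LOCALLY at `(π)`).  Then `π ^ p ∣ f − g ^ p`
for some `g ∈ R`. [cite: Kunz1969, Thm. 2.1] [folklore] -/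
theorem exists_global_of_local_frobenius_congruence [IsRegularLocalRing R] [PerfectField (ResidueField R)]
    (hF : IsFFinite p 1 R) {π : R} (hπ : Prime π) {f a s : R} (hs : ¬ π ∣ s)
    (h : π ^ p ∣ s ^ p * f - a ^ p) : ∃ g : R, π ^ p ∣ f - g ^ p := by
  classical
  haveI : IsDomain R := isDomain_of_isRegularLocalRing R
  have hp : p.Prime := Fact.out
  -- Kunz basis `b α = x^α` of `R` over `B = ρ(R)`
  obtain ⟨x, hx⟩ := exists_regularSystemOfParameters (R := R)
  obtain ⟨b, hb⟩ := exists_basis_frobeniusPower_monomials (p := p) rfl x hx hF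
  have hb0 : b 0 = 1 := by
    rw [hb]
    exact Finset.prod_eq_one fun i _ => by simp
  -- the congruence as a `B`-linear identity
  obtain ⟨r, hr⟩ := h
  have hsB : s ^ p ∈ frobeniusPowerSubring R p 1 := pow_mem_frobeniusPowerSubring_one s
  have haB : a ^ p ∈ frobeniusPowerSubring R p 1 := pow_mem_frobeniusPowerSubring_one a
  have hπB : π ^ p ∈ frobeniusPowerSubring R p 1 := pow_mem_frobeniusPowerSubring_one π
  have hlin : (⟨s ^ p, hsB⟩ : frobeniusPowerSubring R p 1) • f -
      (⟨a ^ p, haB⟩ : frobeniusPowerSubring R p 1) • b 0 =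
        (⟨π ^ p, hπB⟩ : frobeniusPowerSubring R p 1) • r := by
    rw [hb0, Subring.smul_def, Subring.smul_def, Subring.smul_def, smul_eq_mul, smul_eq_mul, smul_eq_mul,
      mul_one]
    exact hr
  -- compare `x^α`-coordinates for `α ≠ 0`
  have hcoef : ∀ α, α ≠ 0 → s ^ p * (b.repr f α : R) = π ^ p * (b.repr r α : R) := by
    intro α hα
    have h1 := congrArg (fun v => (b.repr v α : R)) hlin
    simp only [map_sub, map_smul, Finsupp.sub_apply, Finsupp.smul_apply, Module.Basis.repr_self,
      Finsupp.single_apply, smul_eq_mul] at h1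
    rw [if_neg (Ne.symm hα), mul_zero, sub_zero] at h1
    simpa [Subring.coe_mul] using h1
  -- hence `π ^ p ∣ c_α · x^α` for `α ≠ 0`
  have hdvd : ∀ α, α ≠ 0 → π ^ p ∣ (b.repr f α : R) * b α := by
    intro α hα
    obtain ⟨γ, hγ⟩ := exists_pow_eq_of_mem (b.repr f α).2
    obtain ⟨ϱ, hϱ⟩ := exists_pow_eq_of_mem (b.repr r α).2
    have h1 := hcoef α hα
    rw [← hγ, ← hϱ, ← mul_pow, ← mul_pow] at h1
    -- Frobenius is injective on the domain `R`
    have h2 : s * γ = π * ϱ := frobenius_inj R p h1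
    have h3 : π ∣ γ := by
      rcases hπ.dvd_or_dvd (Dvd.intro _ h2.symm) with h | h
      · exact absurd h hs
      · exact h
    refine Dvd.dvd.mul_right ?_ _
    rw [← hγ]
    exact pow_dvd_pow_of_dvd h3 p
  -- `f = Σ_α c_α x^α`; split off `α = 0`
  obtain ⟨γ₀, hγ₀⟩ := exists_pow_eq_of_mem (b.repr f 0).2
  refine ⟨γ₀, ?_⟩
  have hsum : f = ∑ α, (b.repr f α : R) * b α := by
    conv_lhs => rw [← b.sum_repr f]
    simp only [Subring.smul_def, smul_eq_mul]
  have hsplit : f - γ₀ ^ p = ∑ α ∈ Finset.univ.erase 0, (b.repr f α : R) * b α := by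
    have h1 : ∑ α, (b.repr f α : R) * b α =
        (b.repr f 0 : R) * b 0 + ∑ α ∈ Finset.univ.erase 0, (b.repr f α : R) * b α :=
      (Finset.add_sum_erase _ _ (Finset.mem_univ _)).symm
    rw [hb0, mul_one, ← hγ₀] at h1
    calc f - γ₀ ^ p = (∑ α, (b.repr f α : R) * b α) - γ₀ ^ p := by rw [← hsum]
      _ = _ := by rw [h1]; ring
  rw [hsplit]
  exact Finset.dvd_sum fun α hα => hdvd α (Finset.ne_of_mem_erase hα)

end Core

/-! ### The subring form (members of a run inside the function field) -/

section SubringForm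

variable {K : Type} [Field K] {p : ℕ} [Fact p.Prime] [CharP K p]

/-- **(N5), subring form.** `R ⊆ K` a subring, regular local, F-finite, residue field perfect; `π ∈ R` prime;
`f ∈ R`; `θ, ρ ∈ K` FRACTIONS OF `R` WITH DENOMINATORS PRIME TO `π` (i.e. elements of `R_{(π)} ⊆ K`) with
`f − θ ^ p = π ^ p · ρ`.  Then `π ^ p ∣ f − g ^ p` in `R` for some `g ∈ R`. [cite: Kunz1969, Thm. 2.1] [folklore] -/
theorem exists_global_of_local_frobenius_congruence_subring (R : Subring K) [IsRegularLocalRing R]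
    [PerfectField (ResidueField R)] (hF : IsFFinite p 1 R) {π : R} (hπ : Prime π) (f : R) {θ ρ : K}
    (hθ : ∃ a s : R, ¬ π ∣ s ∧ θ * s = a) (hρ : ∃ c u : R, ¬ π ∣ u ∧ ρ * u = c)
    (h : (f : K) - θ ^ p = (π : K) ^ p * ρ) : ∃ g : R, π ^ p ∣ f - g ^ p := by
  haveI : IsDomain R := isDomain_of_isRegularLocalRing R
  obtain ⟨a, s, hs, has⟩ := hθ
  obtain ⟨c, u, hu, hcu⟩ := hρ
  refine exists_global_of_local_frobenius_congruence hF hπ (f := f) (a := a * u) (s := s * u)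
    (fun hsu => (hπ.dvd_or_dvd hsu).elim hs hu) ⟨c * u ^ (p - 1) * s ^ p, Subtype.ext ?_⟩
  have hp1 : p = (p - 1) + 1 := (Nat.sub_add_cancel (Fact.out : p.Prime).one_le).symm
  push_cast
  -- `(s u)^p f − (a u)^p = u^p (s^p f − (θ s)^p) = u^p s^p (f − θ^p) = u^p s^p π^p ρ = π^p (ρ u) u^{p-1} s^p`
  have hu' : (c : K) * (u : K) ^ (p - 1) = ρ * (u : K) ^ p := by
    rw [← hcu, mul_assoc, ← pow_succ', ← hp1]
  rw [hu', ← has, show (f : K) = θ ^ p + (π : K) ^ p * ρ from by rw [← h]; ring]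
  ring

end SubringForm

end Summit.ResolutionOfSingularities.ResolutionOfSingularities.Theorems.SwitchingDichotomy.FrobeniusCongruence
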